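import Summits.Schanuel.Schanuel.Theorems.RootDecomp1BHyperFrame03

/-!
# RootDecomp1BHyperFrame — lens 4, generation 32 «HYPER-FRAME CELLS» (HyperFrame.lean f84fe52b…, 1151 l) — continuation (RootDecomp1BHyperFrame04): §P hyper-scaled frames `hyperFrame γ ε ρ` (ℚ-free hypothesis-free), `polarDeg_hyperFrame_ge (hRoy)` (t ≥ 2M+1), the E-line `polarDeg_Escaled_ge` / `kleinPolarSchanuel_at_Escaled`, mixed flags `polarDeg_hyperFlag_ge` / `atCells_hyperFlag` (SRL/T0/W0/W0Init At-cells ∀ m)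

(lens-4 g32 `HyperFrame.lean`, sha256 f84fe52b…46c4, own farm rc 0 · 0 sorry · axioms std; critic VERDICT STATUS L1693 PORT GO LOW; port by census-1 gen 15
in five parts `RootDecomp1BHyperFrame01`–`05` — see the PORT NOTE of part 01 (tree binder `…RootDecomp1EPointTransfer.Roy2014_thm_1_1`); `--supports stmt-Schanuel-24622`; rung 0.)
-/

noncomputable section

open Complex IntermediateField MvPolynomial

namespace Summit.Schanuel.Schanuel.Theorems.RootDecomp1BHyperFrame

open Summit.Schanuel.Schanuel.Theorems.RootDecomp1EPointTransfer (Roy2014_thm_1_1)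

open Summit.Schanuel.Schanuel.Theorems.RootDecomp1KHyper (mvlen mvlen_nonneg abs_coeff_le_mvlen one_le_mvlen
  exists_int_mul_eq_map mvaeval_int_map exists_ball_eval_ne_zero transcendental_ofReal_of_liouville)
open Summit.Schanuel.Schanuel.Theorems.RootDecomp1KHyper.HyperCell (HyperLiouville lambdaH hyperLiouville_lambdaH)
open Summit.Schanuel.Schanuel.Theorems.RootDecomp1BFedFlagCore (KleinIH polarDeg polarField polarGens
  coe_mem_polarField coe_mul_I_mem_polarField exp_coe_mem_polarField exp_coe_mul_I_mem_polarField)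
open Summit.Schanuel.Schanuel.Theorems.RootDecomp1BTameFlagCore (IsWild isAlgebraic_I)
open Summit.Schanuel.Schanuel.Theorems.RootDecomp1BDefectFloorDefs (SharpRelativeLindemannAt TameDefectZeroAt
  WildSharpDefectZeroAt WildSharpDefectZeroInitAt WildSharpInitAt)
open Summit.Schanuel.Schanuel.Theorems.RootDecomp1BDefectFloorCells (polarDeg_le_two_mul_of_algebraic
  isAlgebraic_of_mem_span_algebraic natCast_le_trdeg_of_algebraicIndependent linearIndependent_polar
  isAlgebraic_polarExp)
open Summit.Schanuel.Schanuel.Theorems.RootDecomp1BSRLLogLiouville (sharp_init_snoc)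

section Cells

variable {M : ℕ}

/-- The HYPER-SCALED FRAME `r_i = ρ^{ε_i} γ_i` of an algebraic frame `γ` with exponent pattern `ε`. -/
def hyperFrame (γ : Fin M → ℝ) (ε : Fin M → ℕ) (ρ : ℝ) : Fin M → ℝ := fun i => ρ ^ (ε i) * γ i

/-- the polar vector `y = (γ | iγ)` of the frame -/
def polarVec (γ : Fin M → ℝ) : Fin (M + M) → ℂ :=
  Fin.append (fun j => ((γ j : ℝ) : ℂ)) (fun j => ((γ j : ℝ) : ℂ) * I)

/-- the doubled exponent pattern `(ε | ε)` -/
def polarExpo (ε : Fin M → ℕ) : Fin (M + M) → ℕ := Fin.append ε ε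

/-- The `2M` exponentials `e^{ρ^{ε_j} γ_j}, e^{i ρ^{ε_j} γ_j}` of the frame point are the polar exponentials
`e^{r_j}, e^{i r_j}` of the hyper-scaled frame, hence lie in its polar field. -/
theorem exp_frame_mem_polarField (γ : Fin M → ℝ) (ε : Fin M → ℕ) (ρ : ℝ) (i : Fin (M + M)) :
    cexp ((ρ : ℂ) ^ (polarExpo ε i) * polarVec γ i) ∈ polarField (hyperFrame γ ε ρ) := by
  induction i using Fin.addCases with
  | left j =>
    have h : (ρ : ℂ) ^ (polarExpo ε (Fin.castAdd M j)) * polarVec γ (Fin.castAdd M j) =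
        ((hyperFrame γ ε ρ j : ℝ) : ℂ) := by
      simp only [polarExpo, polarVec, Fin.append_left, hyperFrame, Complex.ofReal_mul,
        Complex.ofReal_pow]
    rw [h]
    exact exp_coe_mem_polarField _ j
  | right j =>
    have h : (ρ : ℂ) ^ (polarExpo ε (Fin.natAdd M j)) * polarVec γ (Fin.natAdd M j) =
        ((hyperFrame γ ε ρ j : ℝ) : ℂ) * I := by
      simp only [polarExpo, polarVec, Fin.append_right, hyperFrame, Complex.ofReal_mul,
        Complex.ofReal_pow, mul_assoc]
    rw [h]
    exact exp_coe_mul_I_mem_polarField _ j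

set_option synthInstance.maxHeartbeats 200000 in
/-- **HYPER-SCALED FRAMES HAVE SURPLUS ONE (mod Roy 2014).**  For an algebraic ℚ-free frame `γ`, an exponent
pattern `ε` taking the value `1` somewhere, and a hyper-Liouville `ρ`:
`t(ρ^{ε_1} γ_1, …, ρ^{ε_M} γ_M) ≥ 2M + 1`. -/
theorem polarDeg_hyperFrame_ge (hRoy : Roy2014_thm_1_1) {γ : Fin M → ℝ}
    (hγalg : ∀ i, IsAlgebraic ℚ ((γ i : ℝ) : ℂ)) (hγ : LinearIndependent ℚ γ) (ε : Fin M → ℕ)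
    {i₀ : Fin M} (hi₀ : ε i₀ = 1) {ρ : ℝ} (hρ : HyperLiouville ρ) :
    ((M + M + 1 : ℕ) : Cardinal) ≤ polarDeg (hyperFrame γ ε ρ) := by
  have hyalg : ∀ i, IsAlgebraic ℚ (polarVec γ i) := isAlgebraic_polarExp γ hγalg
  have hy : LinearIndependent ℚ (polarVec γ) := linearIndependent_polar hγ
  have hF : FrameMeasure (polarVec γ) (polarExpo ε) := frameMeasure_of_roy hRoy hyalg hy (polarExpo ε)
  have hai := algebraicIndependent_cons_of_frameMeasure hF hρ
  have h1 : ((M + M + 1 : ℕ) : Cardinal) ≤ Algebra.trdeg ℚ ↥(IntermediateField.adjoin ℚ (Set.range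
      (Fin.cons (ρ : ℂ) (fun j => cexp ((ρ : ℂ) ^ (polarExpo ε j) * polarVec γ j)) :
        Fin (M + M + 1) → ℂ))) :=
    natCast_le_trdeg_of_algebraicIndependent hai (fun i => IntermediateField.subset_adjoin ℚ _ ⟨i, rfl⟩)
  refine h1.trans (trdeg_adjoin_le_of_isAlgebraic' (polarField (hyperFrame γ ε ρ)) ?_)
  rintro x ⟨i, rfl⟩
  refine Fin.cases ?_ (fun j => ?_) i
  · -- `ρ = (ρ γ_{i₀}) · γ_{i₀}⁻¹` is algebraic over the polar field (which contains the coordinate `ρ γ_{i₀}`)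
    rw [Fin.cons_zero]
    have hγ0 : ((γ i₀ : ℝ) : ℂ) ≠ 0 := by exact_mod_cast hγ.ne_zero i₀
    have hmem : (((ρ ^ (ε i₀) * γ i₀ : ℝ)) : ℂ) ∈ polarField (hyperFrame γ ε ρ) :=
      coe_mem_polarField (hyperFrame γ ε ρ) i₀
    have hρeq : (ρ : ℂ) = (((ρ ^ (ε i₀) * γ i₀ : ℝ)) : ℂ) * (((γ i₀ : ℝ) : ℂ))⁻¹ := by
      rw [hi₀, pow_one, Complex.ofReal_mul, mul_inv_cancel_right₀ hγ0]
    rw [hρeq]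
    exact (isAlgebraic_algebraMap (⟨_, hmem⟩ : ↥(polarField (hyperFrame γ ε ρ)))).mul
      (((hγalg i₀).tower_top (↥(polarField (hyperFrame γ ε ρ)))).inv)
  · rw [Fin.cons_succ]
    exact isAlgebraic_algebraMap
      (⟨_, exp_frame_mem_polarField γ ε ρ j⟩ : ↥(polarField (hyperFrame γ ε ρ)))

/-- A hyper-scaled frame with `0/1` exponent pattern is ℚ-FREE (`ρ` is transcendental, the frame algebraic and
ℚ-free). -/
theorem linearIndependent_hyperFrame {γ : Fin M → ℝ} (hγalg : ∀ i, IsAlgebraic ℚ ((γ i : ℝ) : ℂ))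
    (hγ : LinearIndependent ℚ γ) {ε : Fin M → ℕ} (hε : ∀ i, ε i = 0 ∨ ε i = 1) {ρ : ℝ}
    (hρ : HyperLiouville ρ) : LinearIndependent ℚ (hyperFrame γ ε ρ) := by
  classical
  have htr : Transcendental ℚ ((ρ : ℝ) : ℂ) := transcendental_ofReal_of_liouville hρ.liouville
  rw [Fintype.linearIndependent_iff]
  intro g hg
  obtain ⟨g₀, hg₀⟩ : ∃ g₀ : Fin M → ℚ, ∀ i, g₀ i = if ε i = 0 then g i else 0 := ⟨_, fun _ => rfl⟩
  obtain ⟨g₁, hg₁⟩ : ∃ g₁ : Fin M → ℚ, ∀ i, g₁ i = if ε i = 1 then g i else 0 := ⟨_, fun _ => rfl⟩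
  have hsplit : ∑ i, g i • hyperFrame γ ε ρ i = (∑ i, g₀ i • γ i) + ρ * ∑ i, g₁ i • γ i := by
    rw [Finset.mul_sum, ← Finset.sum_add_distrib]
    refine Finset.sum_congr rfl fun i _ => ?_
    rcases hε i with h | h
    · simp [hyperFrame, hg₀ i, hg₁ i, h, Rat.smul_def]
    · simp [hyperFrame, hg₀ i, hg₁ i, h, Rat.smul_def]
      ring
  rw [hsplit] at hg
  have hA : (∑ i, g₀ i • γ i) ∈ Submodule.span ℚ (Set.range γ) :=
    Submodule.sum_mem _ fun i _ => Submodule.smul_mem _ _ (Submodule.subset_span ⟨i, rfl⟩)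
  have hB : (∑ i, g₁ i • γ i) ∈ Submodule.span ℚ (Set.range γ) :=
    Submodule.sum_mem _ fun i _ => Submodule.smul_mem _ _ (Submodule.subset_span ⟨i, rfl⟩)
  have hB0 : ∑ i, g₁ i • γ i = 0 := by
    by_contra hne
    apply htr
    have hρ' : ρ = -(∑ i, g₀ i • γ i) / ∑ i, g₁ i • γ i := by
      field_simp
      linarith
    rw [hρ', Complex.ofReal_div, Complex.ofReal_neg, div_eq_mul_inv]
    exact (isAlgebraic_of_mem_span_algebraic γ hγalg hA).neg.mul
      (isAlgebraic_of_mem_span_algebraic γ hγalg hB).inv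
  have h1 : ∀ i, g₁ i = 0 := Fintype.linearIndependent_iff.mp hγ g₁ hB0
  rw [hB0, mul_zero, add_zero] at hg
  have h0 : ∀ i, g₀ i = 0 := Fintype.linearIndependent_iff.mp hγ g₀ hg
  intro i
  rcases hε i with h | h
  · have := h0 i
    rw [hg₀ i, if_pos h] at this
    exact this
  · have := h1 i
    rw [hg₁ i, if_pos h] at this
    exact this

/-! ### The E-line `r = ρβ` -/

/-- The E-scaled tuple `ρβ` (β algebraic ℚ-free, ρ hyper-Liouville) is ℚ-free — NO measure hypothesis. -/
theorem li_Escaled {β : Fin M → ℝ} (hβalg : ∀ i, IsAlgebraic ℚ ((β i : ℝ) : ℂ))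
    (hβ : LinearIndependent ℚ β) {ρ : ℝ} (hρ : HyperLiouville ρ) :
    LinearIndependent ℚ (fun i => ρ * β i) := by
  have hfr : hyperFrame β (fun _ => 1) ρ = fun i => ρ * β i := funext fun i => by simp [hyperFrame]
  rw [← hfr]
  exact linearIndependent_hyperFrame hβalg hβ (fun _ => Or.inr rfl) hρ

/-- **THE E-LINE CELL `r = ρβ` (hyper-Liouville E-scaling of an algebraic ℚ-free `β`, `M ≥ 1`).**
`t(ρβ) ≥ 2M + 1`: X(M) — the route target `KleinPolarSchanuel` at `(M, ρβ)` — holds WITH SURPLUS ONE (mod Roy). -/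
theorem polarDeg_Escaled_ge (hRoy : Roy2014_thm_1_1) {β : Fin M → ℝ} (hM : 0 < M)
    (hβalg : ∀ i, IsAlgebraic ℚ ((β i : ℝ) : ℂ)) (hβ : LinearIndependent ℚ β) {ρ : ℝ}
    (hρ : HyperLiouville ρ) :
    ((M + M + 1 : ℕ) : Cardinal) ≤ polarDeg (fun i => ρ * β i) := by
  have hfr : hyperFrame β (fun _ => 1) ρ = fun i => ρ * β i := funext fun i => by simp [hyperFrame]
  rw [← hfr]
  exact polarDeg_hyperFrame_ge hRoy hβalg hβ (fun _ => 1) (i₀ := ⟨0, hM⟩) rfl hρ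

/-- the route target X(M) = `KleinPolarSchanuel` INSTANTIATED at the E-scaled tuple, in its literal `trdeg` shape. -/
theorem kleinPolarSchanuel_at_Escaled (hRoy : Roy2014_thm_1_1) {β : Fin M → ℝ} (hM : 0 < M)
    (hβalg : ∀ i, IsAlgebraic ℚ ((β i : ℝ) : ℂ)) (hβ : LinearIndependent ℚ β) {ρ : ℝ}
    (hρ : HyperLiouville ρ) :
    LinearIndependent ℚ (fun i => ρ * β i) →
      ((M + M : ℕ) : Cardinal) ≤ Algebra.trdeg ℚ ↥(IntermediateField.adjoin ℚ
        (Set.range (Fin.append (fun j => (((fun i => ρ * β i) j : ℝ) : ℂ))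
            (fun j => (((fun i => ρ * β i) j : ℝ) : ℂ) * Complex.I)) ∪
          Set.range (Complex.exp ∘ Fin.append (fun j => (((fun i => ρ * β i) j : ℝ) : ℂ))
            (fun j => (((fun i => ρ * β i) j : ℝ) : ℂ) * Complex.I)))) :=
  fun _ => (Nat.cast_le.mpr (by omega)).trans (polarDeg_Escaled_ge hRoy hM hβalg hβ hρ)

/-! ### Mixed flags `(β | ρβ′)` -/

/-- the exponent pattern `(0, …, 0, 1)`: hyper-scale the LAST coordinate only -/
def lastInd (m : ℕ) : Fin (m + 1) → ℕ := fun i => if i = Fin.last m then 1 else 0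

/-- `lastInd m (last) = 1`. -/
theorem lastInd_last (m : ℕ) : lastInd m (Fin.last m) = 1 := by simp [lastInd]

/-- `lastInd m (castSucc j) = 0`. -/
theorem lastInd_castSucc (m : ℕ) (j : Fin m) : lastInd m (Fin.castSucc j) = 0 := by
  simp [lastInd, (Fin.castSucc_lt_last j).ne]

/-- `lastInd m i ∈ {0, 1}`. -/
theorem lastInd_zero_or_one (m : ℕ) (i : Fin (m + 1)) : lastInd m i = 0 ∨ lastInd m i = 1 := by
  unfold lastInd
  split_ifs <;> simp

/-- the MIXED FLAG `(β | ρβ′) = hyperFrame (β | β′) (0,…,0,1) ρ` -/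
theorem hyperFrame_lastInd {m : ℕ} (βe : Fin (m + 1) → ℝ) (ρ : ℝ) :
    hyperFrame βe (lastInd m) ρ = Fin.snoc (Fin.init βe) (ρ * βe (Fin.last m)) := by
  funext i
  induction i using Fin.lastCases with
  | last => simp [hyperFrame, lastInd_last, Fin.snoc_last]
  | cast j => simp [hyperFrame, lastInd_castSucc, Fin.snoc_castSucc, Fin.init]

/-- The mixed flag is ℚ-free — NO measure hypothesis (`(β | β′)` algebraic ℚ-free, `ρ` hyper-Liouville). -/
theorem li_hyperFlag {m : ℕ} {βe : Fin (m + 1) → ℝ} (halg : ∀ i, IsAlgebraic ℚ ((βe i : ℝ) : ℂ))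
    (hfree : LinearIndependent ℚ βe) {ρ : ℝ} (hρ : HyperLiouville ρ) :
    LinearIndependent ℚ (hyperFrame βe (lastInd m) ρ) :=
  linearIndependent_hyperFrame halg hfree (lastInd_zero_or_one m) hρ

/-- The hyperplane `β = Fin.init` of the mixed flag is SHARP: `t(β) ≤ 2m` (β algebraic) — NO hypothesis. -/
theorem polarDeg_init_hyperFlag_le {m : ℕ} {βe : Fin (m + 1) → ℝ}
    (halg : ∀ i, IsAlgebraic ℚ ((βe i : ℝ) : ℂ)) (ρ : ℝ) :
    polarDeg (Fin.init (hyperFrame βe (lastInd m) ρ)) ≤ ((m + m : ℕ) : Cardinal) := by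
  have hinit : Fin.init (hyperFrame βe (lastInd m) ρ) = Fin.init βe := by
    funext j; simp [Fin.init, hyperFrame, lastInd_castSucc]
  rw [hinit]
  exact polarDeg_le_two_mul_of_algebraic (Fin.init βe) (fun j => halg (Fin.castSucc j))

/-- **THE MIXED-FLAG CELL `(β | ρβ′)`.**  For an algebraic ℚ-free `(β | β′)` of length `m + 1` (i.e. `β`
algebraic ℚ-free and `β′ ∈ ℚ̄ ∩ ℝ ∖ span_ℚ β`) and a hyper-Liouville `ρ`:  `t(β | ρβ′) ≥ 2m + 3` (mod Roy). -/
theorem polarDeg_hyperFlag_ge (hRoy : Roy2014_thm_1_1) {m : ℕ} {βe : Fin (m + 1) → ℝ}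
    (halg : ∀ i, IsAlgebraic ℚ ((βe i : ℝ) : ℂ)) (hfree : LinearIndependent ℚ βe) {ρ : ℝ}
    (hρ : HyperLiouville ρ) :
    ((m + 1 + (m + 1) + 1 : ℕ) : Cardinal) ≤ polarDeg (hyperFrame βe (lastInd m) ρ) :=
  polarDeg_hyperFrame_ge hRoy halg hfree (lastInd m) (lastInd_last m) hρ

/-- The route-1B STEP CELLS at the mixed flag `(β | ρβ′)`: the At-instances of the cruxes SRL 32406
(`SharpRelativeLindemannAt`), T0 32407 (`TameDefectZeroAt`), W0 32408 (`WildSharpDefectZeroAt`, coordinate form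
`WildSharpDefectZeroInitAt`) and of the wild sharp step (`WildSharpInitAt`) all HOLD there (mod Roy) — by the
conclusion `t(r) ≥ 2m + 3 ≥ 2m + 2`; the sharp-init hypothesis of SRL / W0Init is moreover TRUE there
(`polarDeg_init_hyperFlag_le`), so the SRL and W0Init instances are NON-VACUOUS in their degree hypotheses. -/
theorem atCells_hyperFlag (hRoy : Roy2014_thm_1_1) {m : ℕ} {βe : Fin (m + 1) → ℝ}
    (halg : ∀ i, IsAlgebraic ℚ ((βe i : ℝ) : ℂ)) (hfree : LinearIndependent ℚ βe) {ρ : ℝ}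
    (hρ : HyperLiouville ρ) :
    SharpRelativeLindemannAt m (hyperFrame βe (lastInd m) ρ) ∧
      TameDefectZeroAt m (hyperFrame βe (lastInd m) ρ) ∧
      WildSharpDefectZeroAt m (hyperFrame βe (lastInd m) ρ) ∧
      WildSharpDefectZeroInitAt m (hyperFrame βe (lastInd m) ρ) ∧
      WildSharpInitAt m (hyperFrame βe (lastInd m) ρ) := by
  have ht := polarDeg_hyperFlag_ge hRoy halg hfree hρ
  have h1 : ((m + m + 1 : ℕ) : Cardinal) ≤ polarDeg (hyperFrame βe (lastInd m) ρ) :=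
    (Nat.cast_le.mpr (by omega)).trans ht
  have h2 : ((m + 1 + (m + 1) : ℕ) : Cardinal) ≤ polarDeg (hyperFrame βe (lastInd m) ρ) :=
    (Nat.cast_le.mpr (by omega)).trans ht
  exact ⟨fun _ _ _ => h1, fun _ _ _ _ => h2, fun _ _ _ _ _ => h2, fun _ _ _ _ _ => h2, fun _ _ _ _ => h2⟩

end Cells

end Summit.Schanuel.Schanuel.Theorems.RootDecomp1BHyperFrame

end
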